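import Summits.AnomalousDissipation.AnomalousDissipation.Theorems.SolenoidalFractalHomogenisationLagrangianStepSidebandXDefs
import Summits.AnomalousDissipation.AnomalousDissipation.Theorems.SolenoidalFractalHomogenisationLagrangianStepSidebandDefsFrame
import Summits.AnomalousDissipation.AnomalousDissipation.Theorems.SolenoidalFractalHomogenisationLagrangianStepCellChainDefsFrame
import HarnessLib

/-!
# K1L_D `LagrangianRenormalisationStepDesign` (stmt-AnomalousDissipation-27980), registered stub `stub_D1_V0θg` (v28, ruling D28-3 (3)), port-map layer L5:
# the FROZEN-FRAME finite-ξ sideband objects — box-truncated sideband vector of a weak solution (twisted representatives), the twisted finite-ξ augmented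
# generator, twisted unit sources, twisted class projection, truncation tail (shared definitions; reviewed; `--kind definition --supports stmt-AnomalousDissipation-27980 --as helper`)

Summits-side DEFINITIONS file of route `SolenoidalFractalHomogenisation` (prover seat `ad-k1l-cellLawV-w1` g9; port map
`Cruxes/LagrangianRenormalisationStepDesign/Lines/onelevel-vtheta-twist-portmap.md` §3 L5).  The frozen-frame twin of `…SidebandXDefs` (brick T4 of the V0
architecture): definitions with bodies and unfolding / consistency lemmas only; no theorems of substance, no named facts, no sorry.
Dictionary (`…CellChainDefsFrame`, `…SidebandDefsFrame`): `modeRep ↦ modeRepθ … G₀`, `transversalProj w ↦ transversalProjR (twistFreq G₀ w)`,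
`symbTL (majorTranspose 𝔹) ↦ symbTL (majorTranspose (Visc4.conj G₀ 𝔹))`; `classFreq`, `xiCoeff` (flat `êⱼ·ℓ/n`), `box`, `Space`, `coordL`, `slotAmp`, `slotEnvelope`,
`linkCoeff` REUSED BY NAME.
* `sbVecθ W₁ n 𝔹 G₀ F u ℓ R t : Space R` — `z ↦ modeRepθ(k_z, t)`, `z ∈ box R`;
* `genXCompθ / genXθ W₁ n ℓ 𝔹 G₀ γ₁ R t` — the twisted finite-ξ AUGMENTED truncated generator (`genXθ W₁ 1 0 𝔸 G₀ = genθ W₁ 𝔸 G₀`, `genXCompθ_one_zero`);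
* `sourceXCompθ / sourceXθ W₁ n ℓ G₀ R j t`; `projXθ n ℓ G₀ R` (componentwise `P^θ_{k_z}`); `tailVecθ W₁ n 𝔹 G₀ F u ℓ R t`;
* `…_one` consistency lemmas: at `G₀ = 1` each is the flat object.
NOT a proof of anything; rung F-D1.A0 infrastructure.  AD is not proved.
-/

set_option linter.dupNamespace false

noncomputable section

namespace Summit.AnomalousDissipation.AnomalousDissipation.Theorems.SolenoidalFractalHomogenisation.LagrangianStep.Sideband

open Set MeasureTheory Complex UnitAddTorus
open scoped InnerProductSpace
open Literature.Analysis Literature.Analysis.FunctionSpaces Literature.Analysis.FunctionSpaces.Torus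
open Literature.Analysis.FluidPDE Literature.Analysis.FluidPDE.Torus Literature.Analysis.FluidPDE.LatticeShear
open Summit.AnomalousDissipation.AnomalousDissipation.Theorems.SolenoidalFractalHomogenisation.LagrangianStep.CellChain
  (linkCoeff modeRep modeRepθ modeRepθ_one)

variable {k₀ : ℕ}

/-! ## §1 The box-truncated sideband vector of a field (twisted representatives) -/

/-- **The box-truncated sideband vector in the frame `G₀`** of the field `u` (datum `F`) in the class of `ℓ`: `z ↦ modeRepθ(ℓ + n·z, t)`, `z ∈ box R`.
[cite: MajdaKramer1999, §2.2.1.3 (cell problem (49))] [cite: ArmstrongVicol2025, §4.1 (PDF p. 34)] -/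
def sbVecθ (W₁ : LatticeWord k₀) (n : ℕ) (𝔹 : Torus.Visc4 (Fin 3)) (G₀ : Matrix (Fin 3) (Fin 3) ℝ) (F : UnitAddTorus (Fin 3) → EuclideanSpace ℝ (Fin 3))
    (u : ℝ → UnitAddTorus (Fin 3) → EuclideanSpace ℝ (Fin 3)) (ℓ : Fin 3 → ℤ) (R : ℕ) (t : ℝ) : Space R :=
  WithLp.toLp 2 fun z : box R => modeRepθ W₁ n 𝔹 G₀ F u (classFreq n ℓ z.1) t

/-- Components of `sbVecθ`. [cite: Temam1984, Ch. III §1.1] -/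
theorem sbVecθ_apply (W₁ : LatticeWord k₀) (n : ℕ) (𝔹 : Torus.Visc4 (Fin 3)) (G₀ : Matrix (Fin 3) (Fin 3) ℝ)
    (F : UnitAddTorus (Fin 3) → EuclideanSpace ℝ (Fin 3)) (u : ℝ → UnitAddTorus (Fin 3) → EuclideanSpace ℝ (Fin 3)) (ℓ : Fin 3 → ℤ) (R : ℕ) (t : ℝ) (z : box R) :
    sbVecθ W₁ n 𝔹 G₀ F u ℓ R t z = modeRepθ W₁ n 𝔹 G₀ F u (classFreq n ℓ z.1) t := rfl

/-- At `G₀ = 1`, `sbVecθ = sbVec`. [cite: Temam1984, Ch. III §1.1] -/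
theorem sbVecθ_one (W₁ : LatticeWord k₀) (n : ℕ) (𝔹 : Torus.Visc4 (Fin 3)) (F : UnitAddTorus (Fin 3) → EuclideanSpace ℝ (Fin 3))
    (u : ℝ → UnitAddTorus (Fin 3) → EuclideanSpace ℝ (Fin 3)) (ℓ : Fin 3 → ℤ) (R : ℕ) (t : ℝ) :
    sbVecθ W₁ n 𝔹 1 F u ℓ R t = sbVec W₁ n 𝔹 F u ℓ R t := by
  ext z i
  rw [sbVecθ_apply, sbVec_apply, modeRepθ_one]

/-! ## §2 The twisted finite-ξ augmented truncated generator, unit sources and class projection -/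

/-- **The `z`-component of the twisted finite-ξ augmented truncated generator**:
`y ↦ −4π² P^θ_{k_z} T_{(𝔹^{G₀})ᵀ}(k_z) P^θ_{k_z} y_z − γ₁ (y_z − P^θ_{k_z} y_z) − Σⱼ linkCoeffⱼ(k_z,t) • P^θ_{k_z} (αⱼ P^θ_{k_{z−mⱼ}} y_{z−mⱼ} + ᾱⱼ P^θ_{k_{z+mⱼ}} y_{z+mⱼ})`
(`k_w = classFreq n ℓ w`, `P^θ_k = transversalProjR (twistFreq G₀ k)`). [cite: MajdaKramer1999, §2.2.1.3 (cell problem (49))] [cite: ArmstrongVicol2025, §4.1 (PDF p. 34)] -/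
def genXCompθ (W₁ : LatticeWord k₀) (n : ℕ) (ℓ : Fin 3 → ℤ) (𝔹 : Torus.Visc4 (Fin 3)) (G₀ : Matrix (Fin 3) (Fin 3) ℝ) (γ₁ : ℝ) (R : ℕ) (t : ℝ) (z : box R) :
    Space R →L[ℂ] EuclideanSpace ℂ (Fin 3) :=
  -((((4 * Real.pi ^ 2 : ℝ) : ℂ)) • ((transversalProjR (twistFreq G₀ (classFreq n ℓ z.1))).comp
      ((symbTL (Torus.majorTranspose (Torus.Visc4.conj G₀ 𝔹)) (classFreq n ℓ z.1)).comp
      ((transversalProjR (twistFreq G₀ (classFreq n ℓ z.1))).comp (coordL R z.1))))) -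
    ((γ₁ : ℝ) : ℂ) • (coordL R z.1 - (transversalProjR (twistFreq G₀ (classFreq n ℓ z.1))).comp (coordL R z.1)) -
    ∑ j, linkCoeff W₁ n (classFreq n ℓ z.1) j t • ((transversalProjR (twistFreq G₀ (classFreq n ℓ z.1))).comp
      (slotAmp W₁ j • ((transversalProjR (twistFreq G₀ (classFreq n ℓ (z.1 - (W₁.phase j).m)))).comp (coordL R (z.1 - (W₁.phase j).m))) +
        starRingEnd ℂ (slotAmp W₁ j) •
          ((transversalProjR (twistFreq G₀ (classFreq n ℓ (z.1 + (W₁.phase j).m)))).comp (coordL R (z.1 + (W₁.phase j).m)))))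

/-- **The twisted finite-ξ augmented truncated generator** `genXθ … t : Space R →L[ℂ] Space R`. [cite: MajdaKramer1999, §2.2.1.3] -/
def genXθ (W₁ : LatticeWord k₀) (n : ℕ) (ℓ : Fin 3 → ℤ) (𝔹 : Torus.Visc4 (Fin 3)) (G₀ : Matrix (Fin 3) (Fin 3) ℝ) (γ₁ : ℝ) (R : ℕ) (t : ℝ) :
    Space R →L[ℂ] Space R :=
  ((PiLp.continuousLinearEquiv 2 ℂ (fun _ : box R => EuclideanSpace ℂ (Fin 3))).symm : (box R → EuclideanSpace ℂ (Fin 3)) →L[ℂ] Space R).comp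
    (ContinuousLinearMap.pi fun z => genXCompθ W₁ n ℓ 𝔹 G₀ γ₁ R t z)

/-- Components of `genXθ`. [cite: MajdaKramer1999, §2.2.1.3] -/
theorem genXθ_apply (W₁ : LatticeWord k₀) (n : ℕ) (ℓ : Fin 3 → ℤ) (𝔹 : Torus.Visc4 (Fin 3)) (G₀ : Matrix (Fin 3) (Fin 3) ℝ) (γ₁ : ℝ) (R : ℕ) (t : ℝ)
    (y : Space R) (z : box R) : genXθ W₁ n ℓ 𝔹 G₀ γ₁ R t y z = genXCompθ W₁ n ℓ 𝔹 G₀ γ₁ R t z y := by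
  simp [genXθ]

/-- **At `ℓ = 0`, `n = 1` the twisted finite-ξ generator is the twisted `ξ = 0` generator** (the one inside `psiStarθ`), componentwise.
[cite: MajdaKramer1999, §2.2.1.3] -/
theorem genXCompθ_one_zero (W₁ : LatticeWord k₀) (𝔸 : Torus.Visc4 (Fin 3)) (G₀ : Matrix (Fin 3) (Fin 3) ℝ) (γ₁ : ℝ) (R : ℕ) (t : ℝ) (z : box R) :
    genXCompθ W₁ 1 0 𝔸 G₀ γ₁ R t z = genCompθ W₁ 𝔸 G₀ γ₁ R t z := by
  have h : ∀ w : Fin 3 → ℤ, transversalProjR (twistFreq G₀ (classFreq 1 0 w)) = transversalProjR (twistFreq G₀ w) := fun w => by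
    rw [classFreq_one_zero]
  have h2 : ∀ w : Fin 3 → ℤ, symbTL (Torus.majorTranspose (Torus.Visc4.conj G₀ 𝔸)) (classFreq 1 0 w) =
      symbTL (Torus.majorTranspose (Torus.Visc4.conj G₀ 𝔸)) w := fun w => by rw [classFreq_one_zero]
  have h3 : ∀ (w : Fin 3 → ℤ) j, linkCoeff W₁ 1 (classFreq 1 0 w) j t = linkCoeff W₁ 1 w j t := fun w j => by rw [classFreq_one_zero]
  unfold genXCompθ genCompθ
  rw [h, h2]
  congr 1
  refine Finset.sum_congr rfl fun j _ => ?_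
  rw [h3, h, h]

/-- `genXθ W₁ 1 0 𝔸 G₀ = genθ W₁ 𝔸 G₀`. [cite: MajdaKramer1999, §2.2.1.3] -/
theorem genXθ_one_zero (W₁ : LatticeWord k₀) (𝔸 : Torus.Visc4 (Fin 3)) (G₀ : Matrix (Fin 3) (Fin 3) ℝ) (γ₁ : ℝ) (R : ℕ) (t : ℝ) :
    genXθ W₁ 1 0 𝔸 G₀ γ₁ R t = genθ W₁ 𝔸 G₀ γ₁ R t := by
  ext y z
  rw [genXθ_apply, genθ_apply, genXCompθ_one_zero]

/-- **The `z`-component of the twisted finite-ξ unit source of slot `j`**: `−2πi·envⱼ(t)·αⱼ·P^θ_{k_{mⱼ}} v` at `z = mⱼ`, `−2πi·envⱼ(t)·ᾱⱼ·P^θ_{k_{−mⱼ}} v` at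
`z = −mⱼ`, else `0`. [cite: MajdaKramer1999, §2.2.1.3 (cell problem (49), source term)] -/
def sourceXCompθ (W₁ : LatticeWord k₀) (n : ℕ) (ℓ : Fin 3 → ℤ) (G₀ : Matrix (Fin 3) (Fin 3) ℝ) (R : ℕ) (j : Fin k₀) (t : ℝ) (z : box R) :
    EuclideanSpace ℂ (Fin 3) →L[ℂ] EuclideanSpace ℂ (Fin 3) :=
  (if z.1 = (W₁.phase j).m then (-(2 * Real.pi * Complex.I * ((slotEnvelope W₁ j t : ℝ) : ℂ) * slotAmp W₁ j)) •
      transversalProjR (twistFreq G₀ (classFreq n ℓ z.1)) else 0) +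
  (if z.1 = -(W₁.phase j).m then
      (-(2 * Real.pi * Complex.I * ((slotEnvelope W₁ j t : ℝ) : ℂ) * starRingEnd ℂ (slotAmp W₁ j))) • transversalProjR (twistFreq G₀ (classFreq n ℓ z.1))
    else 0)

/-- **The twisted finite-ξ unit source of slot `j`** `sourceXθ … j t : ℂ³ →L[ℂ] Space R`. [cite: MajdaKramer1999, §2.2.1.3] -/
def sourceXθ (W₁ : LatticeWord k₀) (n : ℕ) (ℓ : Fin 3 → ℤ) (G₀ : Matrix (Fin 3) (Fin 3) ℝ) (R : ℕ) (j : Fin k₀) (t : ℝ) :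
    EuclideanSpace ℂ (Fin 3) →L[ℂ] Space R :=
  ((PiLp.continuousLinearEquiv 2 ℂ (fun _ : box R => EuclideanSpace ℂ (Fin 3))).symm : (box R → EuclideanSpace ℂ (Fin 3)) →L[ℂ] Space R).comp
    (ContinuousLinearMap.pi fun z => sourceXCompθ W₁ n ℓ G₀ R j t z)

/-- Components of `sourceXθ`. [cite: MajdaKramer1999, §2.2.1.3] -/
theorem sourceXθ_apply (W₁ : LatticeWord k₀) (n : ℕ) (ℓ : Fin 3 → ℤ) (G₀ : Matrix (Fin 3) (Fin 3) ℝ) (R : ℕ) (j : Fin k₀) (t : ℝ)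
    (v : EuclideanSpace ℂ (Fin 3)) (z : box R) : sourceXθ W₁ n ℓ G₀ R j t v z = sourceXCompθ W₁ n ℓ G₀ R j t z v := by
  simp [sourceXθ]

/-- **The twisted class-transversal projection** `projXθ n ℓ G₀ R : Space R →L[ℂ] Space R`, `(projXθ y)_z = P^θ_{k_z} y_z`. [cite: Temam1984, Ch. III §1.1] -/
def projXθ (n : ℕ) (ℓ : Fin 3 → ℤ) (G₀ : Matrix (Fin 3) (Fin 3) ℝ) (R : ℕ) : Space R →L[ℂ] Space R :=
  ((PiLp.continuousLinearEquiv 2 ℂ (fun _ : box R => EuclideanSpace ℂ (Fin 3))).symm : (box R → EuclideanSpace ℂ (Fin 3)) →L[ℂ] Space R).comp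
    (ContinuousLinearMap.pi fun z => (transversalProjR (twistFreq G₀ (classFreq n ℓ z.1))).comp (coordL R z.1))

/-- Components of `projXθ`. [cite: Temam1984, Ch. III §1.1] -/
theorem projXθ_apply (n : ℕ) (ℓ : Fin 3 → ℤ) (G₀ : Matrix (Fin 3) (Fin 3) ℝ) (R : ℕ) (y : Space R) (z : box R) :
    projXθ n ℓ G₀ R y z = transversalProjR (twistFreq G₀ (classFreq n ℓ z.1)) (y z) := by
  simp [projXθ, coordL_apply_of_mem z.2]

/-! ## §3 The truncation tail -/

/-- **The twisted truncation tail** of the box-truncated chain of `u` in the class of `ℓ`: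
`(tailVecθ)_z = −Σⱼ linkCoeffⱼ(k_z,t) • P^θ_{k_z}(αⱼ·[z−mⱼ ∉ box ∪ {0}]·y_{z−mⱼ} + ᾱⱼ·[z+mⱼ ∉ box ∪ {0}]·y_{z+mⱼ})` (twisted representatives).
[cite: MajdaKramer1999, §2.2.1.3] -/
def tailVecθ (W₁ : LatticeWord k₀) (n : ℕ) (𝔹 : Torus.Visc4 (Fin 3)) (G₀ : Matrix (Fin 3) (Fin 3) ℝ) (F : UnitAddTorus (Fin 3) → EuclideanSpace ℝ (Fin 3))
    (u : ℝ → UnitAddTorus (Fin 3) → EuclideanSpace ℝ (Fin 3)) (ℓ : Fin 3 → ℤ) (R : ℕ) (t : ℝ) : Space R :=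
  open Classical in
  WithLp.toLp 2 fun z : box R =>
    -∑ j, linkCoeff W₁ n (classFreq n ℓ z.1) j t • transversalProjR (twistFreq G₀ (classFreq n ℓ z.1))
      (slotAmp W₁ j • (if (z.1 - (W₁.phase j).m ∉ box R ∧ z.1 - (W₁.phase j).m ≠ 0) then
          modeRepθ W₁ n 𝔹 G₀ F u (classFreq n ℓ (z.1 - (W₁.phase j).m)) t else 0) +
        starRingEnd ℂ (slotAmp W₁ j) •
          (if (z.1 + (W₁.phase j).m ∉ box R ∧ z.1 + (W₁.phase j).m ≠ 0) then modeRepθ W₁ n 𝔹 G₀ F u (classFreq n ℓ (z.1 + (W₁.phase j).m)) t else 0))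

open Classical in
/-- Components of `tailVecθ`. [cite: MajdaKramer1999, §2.2.1.3] -/
theorem tailVecθ_apply (W₁ : LatticeWord k₀) (n : ℕ) (𝔹 : Torus.Visc4 (Fin 3)) (G₀ : Matrix (Fin 3) (Fin 3) ℝ)
    (F : UnitAddTorus (Fin 3) → EuclideanSpace ℝ (Fin 3)) (u : ℝ → UnitAddTorus (Fin 3) → EuclideanSpace ℝ (Fin 3)) (ℓ : Fin 3 → ℤ) (R : ℕ) (t : ℝ)
    (z : box R) :
    tailVecθ W₁ n 𝔹 G₀ F u ℓ R t z =
      -∑ j, linkCoeff W₁ n (classFreq n ℓ z.1) j t • transversalProjR (twistFreq G₀ (classFreq n ℓ z.1))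
        (slotAmp W₁ j • (if (z.1 - (W₁.phase j).m ∉ box R ∧ z.1 - (W₁.phase j).m ≠ 0) then
            modeRepθ W₁ n 𝔹 G₀ F u (classFreq n ℓ (z.1 - (W₁.phase j).m)) t else 0) +
          starRingEnd ℂ (slotAmp W₁ j) •
            (if (z.1 + (W₁.phase j).m ∉ box R ∧ z.1 + (W₁.phase j).m ≠ 0) then modeRepθ W₁ n 𝔹 G₀ F u (classFreq n ℓ (z.1 + (W₁.phase j).m)) t
              else 0)) := rfl

/-! ## §4 Consistency at the identity frame -/

/-- `genXCompθ … 1 … = genXComp …`. [cite: MajdaKramer1999, §2.2.1.3] -/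
theorem genXCompθ_one (W₁ : LatticeWord k₀) (n : ℕ) (ℓ : Fin 3 → ℤ) (𝔹 : Torus.Visc4 (Fin 3)) (γ₁ : ℝ) (R : ℕ) (t : ℝ) (z : box R) :
    genXCompθ W₁ n ℓ 𝔹 1 γ₁ R t z = genXComp W₁ n ℓ 𝔹 γ₁ R t z := by
  have hP : ∀ w : Fin 3 → ℤ, transversalProjR (twistFreq (1 : Matrix (Fin 3) (Fin 3) ℝ) w) = transversalProj w :=
    transversalProjR_twistFreq_one
  have hA : Torus.Visc4.conj (1 : Matrix (Fin 3) (Fin 3) ℝ) 𝔹 = 𝔹 := Torus.Visc4.conj_one 𝔹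
  unfold genXCompθ genXComp
  rw [hA, hP (classFreq n ℓ z.1)]
  congr 1
  refine Finset.sum_congr rfl fun j _ => ?_
  rw [hP, hP]

/-- `genXθ … 1 … = genX …`. [cite: MajdaKramer1999, §2.2.1.3] -/
theorem genXθ_one (W₁ : LatticeWord k₀) (n : ℕ) (ℓ : Fin 3 → ℤ) (𝔹 : Torus.Visc4 (Fin 3)) (γ₁ : ℝ) (R : ℕ) (t : ℝ) :
    genXθ W₁ n ℓ 𝔹 1 γ₁ R t = genX W₁ n ℓ 𝔹 γ₁ R t := by
  ext y z
  rw [genXθ_apply, genX_apply, genXCompθ_one]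

/-- `sourceXCompθ … 1 … = sourceXComp …`. [cite: MajdaKramer1999, §2.2.1.3] -/
theorem sourceXCompθ_one (W₁ : LatticeWord k₀) (n : ℕ) (ℓ : Fin 3 → ℤ) (R : ℕ) (j : Fin k₀) (t : ℝ) (z : box R) :
    sourceXCompθ W₁ n ℓ 1 R j t z = sourceXComp W₁ n ℓ R j t z := by
  unfold sourceXCompθ sourceXComp
  rw [transversalProjR_twistFreq_one]

/-- `sourceXθ … 1 … = sourceX …`. [cite: MajdaKramer1999, §2.2.1.3] -/
theorem sourceXθ_one (W₁ : LatticeWord k₀) (n : ℕ) (ℓ : Fin 3 → ℤ) (R : ℕ) (j : Fin k₀) (t : ℝ) :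
    sourceXθ W₁ n ℓ 1 R j t = sourceX W₁ n ℓ R j t := by
  ext v z
  rw [sourceXθ_apply, sourceX_apply, sourceXCompθ_one]

/-- `projXθ n ℓ 1 R = projX n ℓ R`. [cite: Temam1984, Ch. III §1.1] -/
theorem projXθ_one (n : ℕ) (ℓ : Fin 3 → ℤ) (R : ℕ) : projXθ n ℓ 1 R = projX n ℓ R := by
  ext y z
  rw [projXθ_apply, projX_apply, transversalProjR_twistFreq_one]

open Classical in
/-- `tailVecθ … 1 … = tailVec …`. [cite: MajdaKramer1999, §2.2.1.3] -/
theorem tailVecθ_one (W₁ : LatticeWord k₀) (n : ℕ) (𝔹 : Torus.Visc4 (Fin 3)) (F : UnitAddTorus (Fin 3) → EuclideanSpace ℝ (Fin 3))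
    (u : ℝ → UnitAddTorus (Fin 3) → EuclideanSpace ℝ (Fin 3)) (ℓ : Fin 3 → ℤ) (R : ℕ) (t : ℝ) :
    tailVecθ W₁ n 𝔹 1 F u ℓ R t = tailVec W₁ n 𝔹 F u ℓ R t := by
  ext z i
  rw [tailVecθ_apply, tailVec_apply, transversalProjR_twistFreq_one]
  simp only [modeRepθ_one]

end Summit.AnomalousDissipation.AnomalousDissipation.Theorems.SolenoidalFractalHomogenisation.LagrangianStep.Sideband

end
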